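import Literature.NumberTheory.EllipticCurves.LegendreFormValuation
import Literature.NumberTheory.EllipticCurves.TwoTorsion
import Literature.NumberTheory.EllipticCurves.SelmerFiniteProofs
import Literature.NumberTheory.EllipticCurves.GaloisActionProofs
import Literature.NumberTheory.EllipticCurves.VariableChangePoints
import HarnessLib

/-!
# Unramified `4`-torsion at a place `v ∤ 2`: good reduction over `K_v^nr`, or `|j|_v > 1`

Topic `NumberTheory/EllipticCurves`. Let `E` be an elliptic curve over a number field `K`, `v` a
finite place with `v ∤ 2`, `K̄_v` with its spectral valuation `|·|_v`, `𝔐` the prime of the local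
absolute integers and `I_𝔐 ≤ Γ_{K_v}` its inertia group. We prove
(`WeierstrassCurve.exists_variableChange_inertia_or_one_lt_j_of_four_torsion`): **if `I_𝔐` fixes
every point `P ∈ E(K̄_v)` with `4P = O`, then either some change of variables over `K̄_v` with
entries fixed by `I_𝔐` (i.e. defined over `K_v^nr`) makes `E` integral for `|·|_v` with unit
discriminant, or `|j(E)|_v > 1`.**

This is the step "`E[m]` unramified ⟹ good reduction or (potentially) multiplicative reduction" of
the criterion of Néron–Ogg–Shafarevich (Silverman, *AEC*, Thm. VII.7.1) at residue characteristic
`≠ 2`, obtained here without Néron models from the Legendre form (Silverman, *AEC*, Prop. III.1.7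
and the proofs of Prop. VII.5.4(c), VII.5.5): the abscissae `e₁, e₂, e₃` of the points of order `2`
lie in `K_v^nr`, `y² = x(x - A)(x - B)` with `A = e₂ - e₁`, `B = e₃ - e₁` after an unramified change
of variables (`smul_eq_of_isRoot_Ψ₂Sq`), a `4`-torsion point `Q` with `2Q = (A, 0)` — it exists
because doubling `E[4] → E[2]` is onto (`#E[4] = 16`, `#E[2] = 4`, Cor. III.6.4) — is unramified
too and exhibits `A = α²` with `α ∈ K_v^nr` (`sq_eq_of_add_self_eq`), so the Legendre equation
`y² = x(x - 1)(x - λ)`, `λ = B/α²`, is reached over `K_v^nr` (`smul_sq_eq_legendre`); finally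
`λ ≢ 0, 1 (mod 𝔐)` gives a good equation and otherwise `|j|_v > 1` (`isIntegral_legendre_of_val`,
`one_lt_val_j_legendre`, file `LegendreFormValuation`).

## References

* [SilvermanAEC2009] J. H. Silverman, *The Arithmetic of Elliptic Curves*, 2nd ed., GTM 106,
  Springer 2009: Prop. III.1.7, Cor. III.6.4, X.1 Prop. 1.4, proofs of Prop. VII.5.4(c) and
  Prop. VII.5.5, Thm. VII.7.1.
-/

noncomputable section

open scoped Classical NNReal

universe u

open NumberField IsDedekindDomain Field

namespace WeierstrassCurve

open Literature.NumberTheory.EllipticCurves Literature.NumberTheory.GaloisRepresentations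
  IsDedekindDomain.HeightOneSpectrum

variable {K : Type u} [Field K] [NumberField K] (W : WeierstrassCurve K) {v : HeightOneSpectrum (𝓞 K)}
  {w : Valuation (AlgebraicClosure (v.adicCompletion K)) ℝ≥0}
  (hw : ∀ x, (w x : ℝ) = spectralNorm (v.adicCompletion K) (AlgebraicClosure (v.adicCompletion K)) x)

/-! ## Coordinates of points fixed by a Galois element -/

/-- If `σ ∈ Γ_{K_v}` fixes the affine point `(x, y) ∈ E(K̄_v)` then it fixes `x` and `y`.
[folklore] -/
theorem apply_eq_of_smul_some_eq {σ : absoluteGaloisGroup (v.adicCompletion K)}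
    {P : localPoints W (v.adicCompletion K)} {x y : AlgebraicClosure (v.adicCompletion K)}
    {h : (W.baseChange (AlgebraicClosure (v.adicCompletion K))).toAffine.Nonsingular x y}
    (hPe : P = Affine.Point.some x y h) (hP : σ • P = P) :
    absoluteGaloisGroup.toAlgEquiv (v.adicCompletion K) σ x = x ∧
      absoluteGaloisGroup.toAlgEquiv (v.adicCompletion K) σ y = y := by
  rw [localPoints.smul_def, hPe] at hP
  change Affine.Point.map _ (Affine.Point.some x y h) = _ at hP
  rw [Affine.Point.map_some, Affine.Point.some.injEq] at hP
  exact hP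

/-! ## Doubling `E[4] → E[2]` is onto -/

/-- **Doubling maps the `4`-torsion onto the `2`-torsion** of an elliptic curve over `K̄_v`
(characteristic `0`): `#E[4] = 16`, `#E[2] = 4` (Silverman, *AEC*, Cor. III.6.4(b)) and the
fibres of `Q ↦ 2Q` on `E[4]` are cosets of `E[2]`. [cite: SilvermanAEC2009, Cor. III.6.4(b)] -/
theorem exists_two_nsmul_eq_of_two_nsmul_eq_zero [W.IsElliptic]
    {T : (W.baseChange (AlgebraicClosure (v.adicCompletion K))).toAffine.Point} (hT : 2 • T = 0) :
    ∃ Q : (W.baseChange (AlgebraicClosure (v.adicCompletion K))).toAffine.Point,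
      4 • Q = 0 ∧ 2 • Q = T := by
  set L := AlgebraicClosure (v.adicCompletion K)
  haveI : CharZero L :=
    charZero_of_injective_algebraMap (algebraMap K L).injective
  -- the finite sets `E[2]`, `E[4]`
  have hc2 : Nat.card (torsionPoints W L 2) = 2 ^ 2 :=
    W.card_torsionPoints_eq_sq_holds L (n := 2) (by norm_num)
  have hc4 : Nat.card (torsionPoints W L 4) = 4 ^ 2 :=
    W.card_torsionPoints_eq_sq_holds L (n := 4) (by norm_num)
  have hmem2 : ∀ P : (W.baseChange L).toAffine.Point,
      P ∈ (torsionPoints W L 2 : Set (W.baseChange L).toAffine.Point) ↔ 2 • P = 0 := fun P => by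
    rw [SetLike.mem_coe, mem_torsionPoints_iff, show (2 : ℤ) = ((2 : ℕ) : ℤ) from rfl, natCast_zsmul]
  have hmem4 : ∀ P : (W.baseChange L).toAffine.Point,
      P ∈ (torsionPoints W L 4 : Set (W.baseChange L).toAffine.Point) ↔ 4 • P = 0 := fun P => by
    rw [SetLike.mem_coe, mem_torsionPoints_iff, show (4 : ℤ) = ((4 : ℕ) : ℤ) from rfl, natCast_zsmul]
  have hfin2 : (torsionPoints W L 2 : Set (W.baseChange L).toAffine.Point).Finite := by
    haveI : Finite (torsionPoints W L 2) := Nat.finite_of_card_ne_zero (by rw [hc2]; norm_num)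
    exact Set.toFinite _
  have hfin4 : (torsionPoints W L 4 : Set (W.baseChange L).toAffine.Point).Finite := by
    haveI : Finite (torsionPoints W L 4) := Nat.finite_of_card_ne_zero (by rw [hc4]; norm_num)
    exact Set.toFinite _
  set F₂ := hfin2.toFinset with hF₂
  set F₄ := hfin4.toFinset with hF₄
  have hF₂card : F₂.card = 4 := by
    rw [hF₂, ← Set.ncard_eq_toFinset_card _ hfin2, ← Nat.card_coe_set_eq]
    exact hc2
  have hF₄card : F₄.card = 16 := by
    rw [hF₄, ← Set.ncard_eq_toFinset_card _ hfin4, ← Nat.card_coe_set_eq]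
    exact hc4
  have hF₂mem : ∀ P, P ∈ F₂ ↔ 2 • P = 0 := fun P => by
    rw [hF₂, Set.Finite.mem_toFinset, hmem2]
  have hF₄mem : ∀ P, P ∈ F₄ ↔ 4 • P = 0 := fun P => by
    rw [hF₄, Set.Finite.mem_toFinset, hmem4]
  by_contra hno
  push Not at hno
  -- the image of doubling on `E[4]` misses `T`, so has at most `3` elements
  set d : (W.baseChange L).toAffine.Point → (W.baseChange L).toAffine.Point :=
    fun Q => 2 • Q with hd
  have himg : F₄.image d ⊆ F₂.erase T := by
    intro P hP
    obtain ⟨Q, hQ, rfl⟩ := Finset.mem_image.mp hP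
    rw [hF₄mem] at hQ
    refine Finset.mem_erase.mpr ⟨fun h => hno Q hQ h, (hF₂mem _).mpr ?_⟩
    rw [hd]; simp only
    rw [← mul_nsmul, show 2 * 2 = 4 by norm_num, hQ]
  have hTmem : T ∈ F₂ := (hF₂mem T).mpr hT
  have himgcard : (F₄.image d).card ≤ 3 := by
    have := Finset.card_le_card himg
    rw [Finset.card_erase_of_mem hTmem, hF₂card] at this
    exact this
  -- the fibres are cosets of `E[2]`, of size at most `4`
  have hfib : ∀ b ∈ F₄.image d, (F₄.filter (fun Q => d Q = b)).card ≤ 4 := by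
    intro b hb
    obtain ⟨Q₀, hQ₀, rfl⟩ := Finset.mem_image.mp hb
    rw [← hF₂card]
    refine Finset.card_le_card_of_injOn (fun Q => Q - Q₀) ?_ ?_
    · intro Q hQ
      rw [Finset.mem_coe, Finset.mem_filter] at hQ
      rw [Finset.mem_coe, hF₂mem, nsmul_sub, sub_eq_zero]
      exact hQ.2
    · intro Q _ Q' _ h
      exact sub_left_injective h
  have key := Finset.card_le_mul_card_image F₄ 4 hfib
  rw [hF₄card] at key
  omega

/-! ## The main theorem -/

include hw in
/-- **Unramified `4`-torsion at `v ∤ 2`: good reduction over `K_v^nr` or `|j|_v > 1`.** Let `E` be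
an elliptic curve over a number field `K`, `v ∤ 2` a finite place, and suppose the inertia group
`I_𝔐 ≤ Γ_{K_v}` fixes every `P ∈ E(K̄_v)` with `4P = O`. Then either there is a change of
variables `C` over `K̄_v` with entries fixed by `I_𝔐` such that `C • E_{K̄_v}` is integral for
`|·|_v` with `|Δ|_v = 1` (good reduction over `K_v^nr`), or `|j(E)|_v > 1`. (Silverman, *AEC*,
Thm. VII.7.1 with Prop. VII.5.4(c)/VII.5.5, via the Legendre form III.1.7: the points of order
`2` and a `4`-torsion point halving one of them are defined over `K_v^nr`, so the Legendre
equation `y² = x(x-1)(x-λ)` is reached over `K_v^nr`, and `λ ≢ 0, 1` gives good reduction while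
`λ ≡ 0, 1` or `λ ∉ 𝒪` gives `|j| > 1`.)
[cite: SilvermanAEC2009, Thm. VII.7.1 (proof) with Prop. III.1.7 and Prop. VII.5.5] -/
theorem exists_variableChange_inertia_or_one_lt_j_of_four_torsion [W.IsElliptic]
    {𝔐 : Ideal v.localAbsIntegers} (h2v : (2 : 𝓞 K) ∉ v.asIdeal)
    (hfix : ∀ σ ∈ 𝔐.inertia (absoluteGaloisGroup (v.adicCompletion K)),
      ∀ P : localPoints W (v.adicCompletion K), 4 • P = 0 → σ • P = P) :
    (∃ C : VariableChange (AlgebraicClosure (v.adicCompletion K)),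
      (∀ σ ∈ 𝔐.inertia (absoluteGaloisGroup (v.adicCompletion K)),
        absoluteGaloisGroup.toAlgEquiv (v.adicCompletion K) σ (C.u : AlgebraicClosure _) = C.u ∧
        absoluteGaloisGroup.toAlgEquiv (v.adicCompletion K) σ C.r = C.r ∧
        absoluteGaloisGroup.toAlgEquiv (v.adicCompletion K) σ C.s = C.s ∧
        absoluteGaloisGroup.toAlgEquiv (v.adicCompletion K) σ C.t = C.t) ∧
      (C • W.baseChange (AlgebraicClosure (v.adicCompletion K))).IsIntegral w.integer ∧
      w (C • W.baseChange (AlgebraicClosure (v.adicCompletion K))).Δ = 1) ∨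
    1 < w (algebraMap K (AlgebraicClosure (v.adicCompletion K)) W.j) := by
  set L := AlgebraicClosure (v.adicCompletion K)
  set τ := absoluteGaloisGroup.toAlgEquiv (v.adicCompletion K) with hτ
  set WL := W.baseChange L with hWL
  haveI : CharZero L := charZero_of_injective_algebraMap (algebraMap K L).injective
  have hw2 : w (2 : L) = 1 := by
    have := spectralValuation_intCast_eq_one hw (n := 2) (by exact_mod_cast h2v)
    exact_mod_cast this
  have h2L : (2 : L) ≠ 0 := two_ne_zero
  have hfixK : ∀ (σ : absoluteGaloisGroup (v.adicCompletion K)) (a : K),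
      τ σ (algebraMap K L a) = algebraMap K L a := fun σ a => by
    rw [IsScalarTower.algebraMap_apply K (v.adicCompletion K) L]; exact AlgEquiv.commutes _ _
  -- coordinates of `4`-torsion points are fixed by inertia
  have hfixc : ∀ σ ∈ 𝔐.inertia (absoluteGaloisGroup (v.adicCompletion K)),
      ∀ {x y : L} {h : WL.toAffine.Nonsingular x y},
        4 • (Affine.Point.some x y h : WL.toAffine.Point) = 0 → τ σ x = x ∧ τ σ y = y :=
    fun σ hσ x y h h4 => W.apply_eq_of_smul_some_eq rfl (hfix σ hσ (Affine.Point.some x y h) h4)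
  -- (a) the three points of order `2`
  have hc2 : Nat.card (torsionPoints W L 2) = 2 ^ 2 :=
    W.card_torsionPoints_eq_sq_holds L (n := 2) (by norm_num)
  have hfin2 : (torsionPoints W L 2 : Set WL.toAffine.Point).Finite := by
    haveI : Finite (torsionPoints W L 2) := Nat.finite_of_card_ne_zero (by rw [hc2]; norm_num)
    exact Set.toFinite _
  set F₂ := hfin2.toFinset with hF₂
  have hF₂card : F₂.card = 4 := by
    rw [hF₂, ← Set.ncard_eq_toFinset_card _ hfin2, ← Nat.card_coe_set_eq]; exact hc2
  have hF₂mem : ∀ P, P ∈ F₂ ↔ 2 • P = 0 := fun P => by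
    rw [hF₂, Set.Finite.mem_toFinset, SetLike.mem_coe, mem_torsionPoints_iff,
      show (2 : ℤ) = ((2 : ℕ) : ℤ) from rfl, natCast_zsmul]
  obtain ⟨P₁, hP₁, hP₁n⟩ : ∃ P₁ ∈ F₂, P₁ ∉ ({0} : Finset WL.toAffine.Point) :=
    Finset.exists_mem_notMem_of_card_lt_card (by rw [Finset.card_singleton, hF₂card]; norm_num)
  obtain ⟨P₂, hP₂, hP₂n⟩ : ∃ P₂ ∈ F₂, P₂ ∉ ({0, P₁} : Finset WL.toAffine.Point) :=
    Finset.exists_mem_notMem_of_card_lt_card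
      (lt_of_le_of_lt (Finset.card_le_two) (by rw [hF₂card]; norm_num))
  obtain ⟨P₃, hP₃, hP₃n⟩ : ∃ P₃ ∈ F₂, P₃ ∉ ({0, P₁, P₂} : Finset WL.toAffine.Point) :=
    Finset.exists_mem_notMem_of_card_lt_card
      (lt_of_le_of_lt (Finset.card_le_three) (by rw [hF₂card]; norm_num))
  simp only [Finset.mem_insert, Finset.mem_singleton, not_or] at hP₁n hP₂n hP₃n
  rw [hF₂mem] at hP₁ hP₂ hP₃
  -- (b) their coordinates
  rcases P₁ with _ | ⟨e₁, y₁, h₁⟩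
  · exact absurd rfl hP₁n
  rcases P₂ with _ | ⟨e₂, y₂, h₂⟩
  · exact absurd rfl hP₂n.1
  rcases P₃ with _ | ⟨e₃, y₃, h₃⟩
  · exact absurd rfl hP₃n.1
  have hyrel : ∀ {e y : L} {h : WL.toAffine.Nonsingular e y},
      2 • (Affine.Point.some e y h : WL.toAffine.Point) = 0 → 2 * y + WL.a₁ * e + WL.a₃ = 0 := by
    intro e y h h2P
    rw [two_nsmul, add_eq_zero_iff_eq_neg, Affine.Point.neg_some, Affine.Point.some.injEq] at h2P
    have := h2P.2
    rw [Affine.negY] at this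
    linear_combination this
  have hy₁ := hyrel hP₁
  have hy₂ := hyrel hP₂
  have hy₃ := hyrel hP₃
  have he₁ := WL.isRoot_Ψ₂Sq_of_two_nsmul_eq_zero h₁ hP₁
  have he₂ := WL.isRoot_Ψ₂Sq_of_two_nsmul_eq_zero h₂ hP₂
  have he₃ := WL.isRoot_Ψ₂Sq_of_two_nsmul_eq_zero h₃ hP₃
  have hdist : ∀ {e y e' y' : L} {h : WL.toAffine.Nonsingular e y}
      {h' : WL.toAffine.Nonsingular e' y'}, 2 * y + WL.a₁ * e + WL.a₃ = 0 →
      2 * y' + WL.a₁ * e' + WL.a₃ = 0 →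
      (Affine.Point.some e y h : WL.toAffine.Point) ≠ Affine.Point.some e' y' h' → e ≠ e' := by
    intro e y e' y' h h' hy hy' hne hee
    apply hne
    have hyy : y = y' := by
      refine mul_left_cancel₀ h2L ?_
      linear_combination hy - hy' - WL.a₁ * hee
    subst hee hyy
    rfl
  have h12 : e₁ ≠ e₂ := hdist hy₁ hy₂ (Ne.symm hP₂n.2)
  have h13 : e₁ ≠ e₃ := hdist hy₁ hy₃ (Ne.symm hP₃n.2.1)
  have h23 : e₂ ≠ e₃ := hdist hy₂ hy₃ (Ne.symm hP₃n.2.2)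
  -- (c) complete the square and translate `(e₁, 0)` to the origin
  have h22 : (2 : L)⁻¹ * 2 = 1 := inv_mul_cancel₀ h2L
  obtain ⟨sC, hs⟩ : ∃ sC : L, 2 * sC + WL.a₁ = 0 :=
    ⟨-WL.a₁ * 2⁻¹, by linear_combination (-WL.a₁) * h22⟩
  obtain ⟨tC, ht⟩ : ∃ tC : L, 2 * tC + WL.a₁ * e₁ + WL.a₃ = 0 :=
    ⟨-(WL.a₁ * e₁ + WL.a₃) * 2⁻¹, by linear_combination (-(WL.a₁ * e₁ + WL.a₃)) * h22⟩
  set C₁ : VariableChange L := ⟨1, e₁, sC, tC⟩ with hC₁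
  set A := e₂ - e₁ with hA
  set B := e₃ - e₁ with hB
  have hV : C₁ • WL = ⟨0, -(A + B), 0, A * B, 0⟩ :=
    smul_eq_of_isRoot_Ψ₂Sq WL h2L he₁ he₂ he₃ h12 h13 h23 hs ht
  have hA0 : A ≠ 0 := sub_ne_zero.mpr (Ne.symm h12)
  -- (d) a `4`-torsion point `Q'` halving `P₂`
  obtain ⟨Q', h4Q', h2Q'⟩ := W.exists_two_nsmul_eq_of_two_nsmul_eq_zero hP₂
  rcases hQ' : Q' with _ | ⟨x', y', h'⟩
  · exfalso
    rw [hQ'] at h2Q'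
    exact Affine.Point.some_ne_zero h₂ (h2Q'.symm.trans (nsmul_zero 2))
  rw [hQ'] at h4Q' h2Q'
  -- (e) transport to `y² = x(x - A)(x - B)` and halve
  set eP := VariableChange.pointEquiv WL C₁ with heP
  set eV := Affine.Point.congrEquiv hV with heV
  set x₀ := C₁.toX x' with hx₀
  set y₀ := C₁.toY x' y' with hy₀
  have hx₀' : x₀ = x' - e₁ := by
    rw [hx₀, VariableChange.toX_def, hC₁]; simp
  have hy₀' : y₀ = y' - sC * (x' - e₁) - tC := by
    rw [hy₀, VariableChange.toY_def, hC₁]; simp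
  have hTx : C₁.toX e₂ = A := by rw [VariableChange.toX_def, hC₁]; simp [hA]
  have hTy : C₁.toY e₂ y₂ = 0 := by
    rw [VariableChange.toY_def, hC₁]
    simp only [inv_one, Units.val_one, one_pow, one_mul]
    refine mul_left_cancel₀ h2L ?_
    linear_combination hy₂ - (e₂ - e₁) * hs - ht
  have hadd : eV (eP (Affine.Point.some x' y' h')) + eV (eP (Affine.Point.some x' y' h')) =
      eV (eP (Affine.Point.some e₂ y₂ h₂)) := by
    rw [← map_add, ← map_add, ← two_nsmul, h2Q']
  rw [heP, VariableChange.pointEquiv_some, VariableChange.pointEquiv_some, heV,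
    Affine.Point.congrEquiv_some, Affine.Point.congrEquiv_some] at hadd
  have hTV : (⟨0, -(A + B), 0, A * B, 0⟩ : WeierstrassCurve L).toAffine.Nonsingular A 0 := by
    have := (hV ▸ (VariableChange.nonsingular_iff WL C₁ e₂ y₂).mpr h₂ :
      (⟨0, -(A + B), 0, A * B, 0⟩ : WeierstrassCurve L).toAffine.Nonsingular (C₁.toX e₂) (C₁.toY e₂ y₂))
    rwa [hTx, hTy] at this
  simp only [hTx, hTy] at hadd
  obtain ⟨hxA, hy0, hAsq⟩ := sq_eq_of_add_self_eq h2L _ _ hadd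
  -- (f) `A = α²` with `α ∈ K_v^nr`
  set α : L := x₀ * (x₀ - A) / y₀ with hα
  have hα0 : α ≠ 0 := by
    intro h0; apply hA0; rw [hAsq, h0]; ring
  have hfixe : ∀ σ ∈ 𝔐.inertia (absoluteGaloisGroup (v.adicCompletion K)),
      τ σ e₁ = e₁ ∧ τ σ e₂ = e₂ ∧ τ σ e₃ = e₃ ∧ τ σ x' = x' ∧ τ σ y' = y' := by
    intro σ hσ
    have h4 : ∀ {e y : L} {h : WL.toAffine.Nonsingular e y},
        2 • (Affine.Point.some e y h : WL.toAffine.Point) = 0 →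
        4 • (Affine.Point.some e y h : WL.toAffine.Point) = 0 := by
      intro e y h h2P
      rw [show 4 = 2 * 2 from rfl, mul_nsmul, h2P, nsmul_zero]
    exact ⟨(hfixc σ hσ (h4 hP₁)).1, (hfixc σ hσ (h4 hP₂)).1, (hfixc σ hσ (h4 hP₃)).1,
      (hfixc σ hσ h4Q').1, (hfixc σ hσ h4Q').2⟩
  have hfixa₁ : ∀ σ : absoluteGaloisGroup (v.adicCompletion K), τ σ WL.a₁ = WL.a₁ :=
    fun σ => hfixK σ W.a₁
  have hfixa₃ : ∀ σ : absoluteGaloisGroup (v.adicCompletion K), τ σ WL.a₃ = WL.a₃ :=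
    fun σ => hfixK σ W.a₃
  have hfixsC : ∀ σ : absoluteGaloisGroup (v.adicCompletion K), τ σ sC = sC := fun σ => by
    have h' : 2 * τ σ sC + WL.a₁ = 0 := by
      have := congrArg (τ σ) hs
      rwa [map_add, map_mul, map_ofNat, hfixa₁, map_zero] at this
    refine mul_left_cancel₀ h2L ?_
    linear_combination h' - hs
  have hfixtC : ∀ σ ∈ 𝔐.inertia (absoluteGaloisGroup (v.adicCompletion K)), τ σ tC = tC := by
    intro σ hσ
    have h' : 2 * τ σ tC + WL.a₁ * e₁ + WL.a₃ = 0 := by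
      have := congrArg (τ σ) ht
      rwa [map_add, map_add, map_mul, map_mul, map_ofNat, hfixa₁, hfixa₃, (hfixe σ hσ).1,
        map_zero] at this
    refine mul_left_cancel₀ h2L ?_
    linear_combination h' - ht
  have hfixα : ∀ σ ∈ 𝔐.inertia (absoluteGaloisGroup (v.adicCompletion K)), τ σ α = α := by
    intro σ hσ
    obtain ⟨f1, f2, -, fx, fy⟩ := hfixe σ hσ
    have ftC : τ σ tC = tC := hfixtC σ hσ
    have fx₀ : τ σ x₀ = x₀ := by rw [hx₀', map_sub, fx, f1]
    have fy₀ : τ σ y₀ = y₀ := by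
      rw [hy₀', map_sub, map_sub, map_mul, map_sub, fy, hfixsC, fx, f1, ftC]
    have fA : τ σ A = A := by rw [hA, map_sub, f2, f1]
    rw [hα, map_div₀, map_mul, map_sub, fx₀, fA, fy₀]
  -- (g) rescale by `α`: the Legendre equation `λ = B/α²`
  set C : VariableChange L := ⟨Units.mk0 α hα0, 0, 0, 0⟩ * C₁ with hC
  have hCW : C • WL = ⟨0, -(1 + B / α ^ 2), 0, B / α ^ 2, 0⟩ := by
    rw [hC, mul_smul, hV, show A = α ^ 2 from hAsq]
    exact smul_sq_eq_legendre hα0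
  have hCfix : ∀ σ ∈ 𝔐.inertia (absoluteGaloisGroup (v.adicCompletion K)),
      τ σ (C.u : L) = C.u ∧ τ σ C.r = C.r ∧ τ σ C.s = C.s ∧ τ σ C.t = C.t := by
    intro σ hσ
    obtain ⟨f1, -, -, -, -⟩ := hfixe σ hσ
    simp only [hC, hC₁, VariableChange.mul_def, Units.val_mk0, Units.val_one,
      mul_one, one_pow, zero_mul, zero_add, mul_zero, add_zero]
    exact ⟨hfixα σ hσ, f1, hfixsC σ, hfixtC σ hσ⟩
  -- (h) dichotomy on `λ`
  set la : L := B / α ^ 2 with hla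
  by_cases hgood : w la = 1 ∧ w (la - 1) = 1
  · left
    obtain ⟨hint, hΔ⟩ := isIntegral_legendre_of_val hw2 hgood.1 hgood.2
    refine ⟨C, hCfix, ?_, ?_⟩
    · rw [hCW]; exact hint
    · rw [hCW]; exact hΔ
  · right
    haveI hE : (⟨0, -(1 + la), 0, la, 0⟩ : WeierstrassCurve L).IsElliptic := by
      rw [← hCW]; infer_instance
    have hj := one_lt_val_j_legendre hw2 (la := la) hgood
    have key : ∀ (X : WeierstrassCurve L) (hX : X = C • WL) [X.IsElliptic],
        X.j = (C • WL).j := by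
      intro X hX _; subst hX; rfl
    have hj' : (C • WL).j = algebraMap K L W.j :=
      (variableChange_j WL C).trans (W.map_j (algebraMap K L))
    rw [key _ hCW.symm, hj'] at hj
    exact hj

end WeierstrassCurve

end
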